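import Literature.MathematicalPhysics.QuantumFieldTheory.Balaban1983to89.B9Eq326ConjugatedDeltaATower
import Literature.MathematicalPhysics.QuantumFieldTheory.Balaban1983to89.B9Eq3126ConjugatedQG1QLetters

/-!
# `Balaban1983to89.B9Eq3126ConjugatedQG1QInvTower` — T. Bałaban, *Propagators for lattice gauge theories in a background field*, Commun. Math. Phys. **99**
# (1985) 389–434 [Balaban1985BackgroundPropagators] (3.42) p. 398, (3.26) p. 395, (3.49) p. 399, (3.126) p. 420, Thm 3.11 p. 416 with [Balaban1985Variational]
# (45) p. 285, (110) p. 294: **THE CONJUGATED INVERSE GRAM OPERATOR `(Q_kG₁Q_k*)⁻¹` IS BOUNDED ON THE COMBES–THOMAS CIRCLE AT EVERY HEIGHT OF THE TOWER —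
# `‖S_F (Q_kG₁Q_k*)⁻¹ S_F⁻¹‖ ≤ 2∕μ₁`** — the TOWER PORT of `B9Eq3126ConjugatedQG1QInv` (one step, `laplaceAofU` ∕ `G1ofU`, abstract `Q`) to
# `B9Eq326OperatorTower.laplaceAk` ∕ `G1k` ∕ the composite averaging `Q_k(U) = QkW` ((3.42)) on the big-block torus `towerP L m (n+1) → m`, with
# `(Q_kG₁Q_k*)⁻¹ = B11Eq103H1Complex.KinvLatticeK hpos hQ` (`Q_k` onto = `B9Eq326OperatorTower.QkW_surjective` under the tower regularity `hαL`, displayed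
# here as `hQs`); text = the one-step file's with `fineP ↦ towerP … (n+1)`, `laplaceAofU ↦ laplaceAk`, `G1ofU ↦ G1k`, `Q ↦ QkW`, over
# `B9Eq326ConjugatedDeltaATower` (CDT) exactly as that file ports `B9Eq326ConjugatedDeltaA`; the abstract letters `B9Eq3126ConjugatedQG1QLetters` ∕
# `B9Eq326ConjugatedDeltaAResolvent` ∕ `…Letters` are height-free and used verbatim

statement-level skeleton of published theorems with citation tags; proofs where landed; nothing here is a claim about the Yang–Mills mass gap

CITATION HEADER (lean-in-tree rule).  Audit cell `pub-balaban`, sub-cell `t4`, BINDER row NE9 (road ΔA-CT, tower form; NE9 formalisation-swarm leaf prover 03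
`b2b-balaban-t4-ne9-formalise-leaf-03` gen 75).  Sources READ first-hand: [Balaban1985BackgroundPropagators] p. 398 (3.42), p. 399 (3.49) (print's `δ₀` NOT
asserted), p. 416 Thm 3.11 (DISPLAYED as `hpos`, `hcoer`, `hX1`), p. 420 (3.126); [Balaban1985Variational] p. 285 (45), p. 294 (110).  Combes–Thomas is
[folklore]; print's route (Lemma 3.10, random walk) is NOT followed.

WHAT IS PROVED (sorry-free; proof lane — no `def`).
* `X1_factorisation`, `conjKinv_rightInverse` (via `hK_lattice`), `G1k_laplaceAk` ∕ `laplaceAk_G1k` (`greenK_apply` ∕ `apply_greenK`), `conjInv_conjDeltaAk`,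
  `conj_letters` (CDT's four discharged curl ∕ cocurl ∕ div ∕ grad letters in one lemma);
* **`norm_conjX1_sub_X1_le`** — `‖(S_FQ_kS⁻¹)(SG₁S⁻¹)(SQ_k†S_F⁻¹)g − Q_kG₁Q_k†g‖ ≤ s₁‖g‖` at height `n+1`;
* **`norm_conjKinv_le`** — `‖(S_F∘(Q_kG₁Q_k*)⁻¹∘S_F⁻¹)v‖ ≤ (2∕μ₁)‖v‖` at height `n+1`, on the circle, in the windows `small`, `small2`.
HONEST SCOPE.  Every height `n`, every `U` of the letters, `χ`, `κ`; NO `η`, NO volume, NO height in the constants; DISPLAYED: `γ`, `μ₁`, `p_K`, `β_K`, `C_Q`,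
the `Q_k(U)` seams (no supplier in the tree), `ρ` (supplier `B9Eq349ConjugatedProjectionDifferenceChainTower`), `C_P` (supplier
`B9Eq325ProjectionDivergenceQuarterKappaTower`), `hQs`; no decay concluded here (the `_cast` point read-out is the next file); NOT NE9 (cell pub-balaban: NE9
NOT PRINTED ∕ NOT PROVED; «NE9 ⇐ the named binders»; row WALLED ON A MODEL (O-NE9-1; #5 UNRULED); spine PROVED 0∕9; rung (B)+1 on a finite T⁴ — NOT infinite
volume, NOT mass gap, NOT BetaPertH, NOT Clay; HONEST DEPENDENCY: continuum YM on T⁴ ⇐ BetaPertH ∧ nine spine estimates (0/9 proved); BetaPertH ⇐ (D1) ∧ (D4)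
∧ CAP+tail).  NEW file; nothing modified.  Net new unproved facts: 0.
-/

noncomputable section

open scoped InnerProductSpace ComplexConjugate BigOperators

namespace Literature.MathematicalPhysics.QuantumFieldTheory.Balaban1983to89.B9Eq3126ConjugatedQG1QInvTower

open B4Sect5Torus (TSite)
open B9SectCLatticeCarrier (Bond bpos btgt)
open B9Eq311L2Pairing (WL2)
open B7Prop1Explicit (U1)
open B9Eq315QTower (towerP)
open B9Eq315QTorus (perCfg cornerSite)
open B7Prop1Explicit (Wcx boxVec)
open B11Eq103H1Complex (SiteL2K BondL2K greenK apply_greenK greenK_apply covDerivL2K covDivL2K adjoint_covDerivL2K KinvLatticeK hK_lattice)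
open B9Eq310HessianOperator (adTransportW PlaqL2K covCurlL2K covCoCurlL2K curvOp adjoint_covCurlL2K)
open B9Eq3101ConjugationLettersChain (norm_adTransportW_le norm_mulOp_covDerivL2K_adTransportW_sub_le)
open B9Eq3101ConjugationLettersCurl (norm_mulOp_covCurlL2K_sub_le norm_mulOp_covDivL2K_sub_le)
open B9Eq3101ConjugationLettersCoCurl (norm_mulOp_covCoCurlL2K_sub_le)
open B9Eq326OperatorTower (laplaceAk RofUk RofUk_isSymmetric G1k QkW)
open B9Eq326ConjugatedDeltaATower (conj_inv_eta' re_inner_RofUk_eq norm_RofUk_le deltaAk_structure conjDeltaAk_apply conjDeltaAk_conjInv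
  apply_inv_apply' apply_apply_inv')
open B9Eq3126ConjugatedQG1QLetters (norm_X1k_sub_X1_le norm_c1k_le)

section Instance

variable {d : ℕ} (L : ℕ) [NeZero L] (m : Fin d → ℕ) [∀ i, NeZero (m i)] (n : ℕ)
  {𝔸 : Type*} [NormedRing 𝔸] [StarRing 𝔸] [NormedAlgebra ℂ 𝔸] [StarModule ℂ 𝔸] [CompleteSpace 𝔸] [NormOneClass 𝔸]
  {W : Type*} [NormedAddCommGroup W] [InnerProductSpace ℂ W] [FiniteDimensional ℂ W] (φ : W ≃ₗ[ℂ] 𝔸) {Mφ Mφ' : ℝ}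
  (hφ : ∀ w, ‖φ w‖ ≤ Mφ * ‖w‖) (hφ' : ∀ X, ‖φ.symm X‖ ≤ Mφ' * ‖X‖) (hMφ : 0 ≤ Mφ) (hMφ' : 0 ≤ Mφ')
  {c₀ : ℝ} [Fact (0 < c₀)] {c₁ : ℝ} [Fact (0 < c₁)] {η : ℝ} (hη : 0 < η) (U : Bond d (towerP L m (n + 1)) → 𝔸ˣ) (hU : ∀ b, U b ∈ U1 𝔸)
  (hRS : ∀ (b : Bond d (towerP L m (n + 1))) (v u : W), ⟪adTransportW φ U b v, u⟫_ℂ = ⟪v, adTransportW φ (fun b => (U b)⁻¹) b u⟫_ℂ)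
  (τ : 𝔸 →ₗ[ℂ] ℂ) (hL : 1 ≤ L) (α : ℕ → ℝ) (hα1 : ∀ j, α j ≤ 1 / 64)
  (hU1 : ∀ (j : ℕ) (x : B7Prop1Explicit.Site d) (κ : Fin d), perCfg (towerP L m (j + 1)) (B9Eq315QTower.UlevOf L m (n + 1) U j) x κ ∈ U1 𝔸)
  (hreg : ∀ (j : ℕ) (y : TSite d (towerP L m j)) (κ : Fin d) (r : Fin d → Fin L),
    ‖((Wcx L (perCfg (towerP L m (j + 1)) (B9Eq315QTower.UlevOf L m (n + 1) U j)) (cornerSite L y) κ (boxVec L r) : 𝔸ˣ) : 𝔸) - 1‖ ≤ α j)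
  (a : ℝ)


variable {κ : ℂ} {χ : TSite d (towerP L m (n + 1)) → ℝ}
  {S Sinv : BondL2K ℂ d (towerP L m (n + 1)) c₀ W →ₗ[ℂ] BondL2K ℂ d (towerP L m (n + 1)) c₀ W}
  (hS : ∀ (g : BondL2K ℂ d (towerP L m (n + 1)) c₀ W) (b : Bond d (towerP L m (n + 1))),
    WL2.equiv ℂ (fun _ : Bond d (towerP L m (n + 1)) => c₀) W (S g) b =
      Complex.exp (κ * (χ (bpos b) : ℂ)) • WL2.equiv ℂ (fun _ : Bond d (towerP L m (n + 1)) => c₀) W g b)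
  (hSinv : ∀ (g : BondL2K ℂ d (towerP L m (n + 1)) c₀ W) (b : Bond d (towerP L m (n + 1))),
    WL2.equiv ℂ (fun _ : Bond d (towerP L m (n + 1)) => c₀) W (Sinv g) b =
      Complex.exp (-(κ * (χ (bpos b) : ℂ))) • WL2.equiv ℂ (fun _ : Bond d (towerP L m (n + 1)) => c₀) W g b)
  {SP SPinv : PlaqL2K ℂ d (towerP L m (n + 1)) c₀ W →ₗ[ℂ] PlaqL2K ℂ d (towerP L m (n + 1)) c₀ W}
  (hSP : ∀ (g : PlaqL2K ℂ d (towerP L m (n + 1)) c₀ W) (p : B9SectCLatticeCarrier.Plaq d (towerP L m (n + 1))),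
    WL2.equiv ℂ (fun _ : B9SectCLatticeCarrier.Plaq d (towerP L m (n + 1)) => c₀) W (SP g) p =
      Complex.exp (κ * (χ p.1 : ℂ)) • WL2.equiv ℂ (fun _ : B9SectCLatticeCarrier.Plaq d (towerP L m (n + 1)) => c₀) W g p)
  (hSPinv : ∀ (g : PlaqL2K ℂ d (towerP L m (n + 1)) c₀ W) (p : B9SectCLatticeCarrier.Plaq d (towerP L m (n + 1))),
    WL2.equiv ℂ (fun _ : B9SectCLatticeCarrier.Plaq d (towerP L m (n + 1)) => c₀) W (SPinv g) p =
      Complex.exp (-(κ * (χ p.1 : ℂ))) • WL2.equiv ℂ (fun _ : B9SectCLatticeCarrier.Plaq d (towerP L m (n + 1)) => c₀) W g p)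
  {SS SSinv : SiteL2K ℂ d (towerP L m (n + 1)) c₀ W →ₗ[ℂ] SiteL2K ℂ d (towerP L m (n + 1)) c₀ W}
  (hSS : ∀ (g : SiteL2K ℂ d (towerP L m (n + 1)) c₀ W) (x : TSite d (towerP L m (n + 1))),
    WL2.equiv ℂ (fun _ : TSite d (towerP L m (n + 1)) => c₀) W (SS g) x =
      Complex.exp (κ * (χ x : ℂ)) • WL2.equiv ℂ (fun _ : TSite d (towerP L m (n + 1)) => c₀) W g x)
  (hSSinv : ∀ (g : SiteL2K ℂ d (towerP L m (n + 1)) c₀ W) (x : TSite d (towerP L m (n + 1))),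
    WL2.equiv ℂ (fun _ : TSite d (towerP L m (n + 1)) => c₀) W (SSinv g) x =
      Complex.exp (-(κ * (χ x : ℂ))) • WL2.equiv ℂ (fun _ : TSite d (towerP L m (n + 1)) => c₀) W g x)

  {SF SFinv : BondL2K ℂ d m c₁ W →ₗ[ℂ] BondL2K ℂ d m c₁ W} (hSFi : ∀ g, SFinv (SF g) = g) (hSFs : ∀ g, SF (SFinv g) = g)

/-! ## §0 Algebra: the factorisation of the conjugated `Q†aQ`, the conjugated right inverse, the left inverse -/

omit [StarRing 𝔸] [StarModule ℂ 𝔸] in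
include hSFi in
/-- **`S(Q_k†(a•Q_k(S⁻¹f))) = a•(S∘Q†∘S_F⁻¹)((S_F∘Q∘S⁻¹)f)`** — the factorisation `hQfac` of `B9Eq326ConjugatedDeltaA.conjDeltaA_apply` for the pair
`Q_κ = S_FQS⁻¹`, `Q′_κ = SQ†S_F⁻¹`. [folklore] [cite: Balaban1985BackgroundPropagators, (3.26) p.395, (3.49) p.399] -/
theorem X1_factorisation (S Sinv : BondL2K ℂ d (towerP L m (n + 1)) c₀ W →ₗ[ℂ] BondL2K ℂ d (towerP L m (n + 1)) c₀ W) (f : BondL2K ℂ d (towerP L m (n + 1)) c₀ W) :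
    S (LinearMap.adjoint (QkW L m n φ U hL α hα1 hU1 hreg (c₀ := c₀) (c₁ := c₁)) (((a : ℝ) : ℂ) • (QkW L m n φ U hL α hα1 hU1 hreg (c₀ := c₀) (c₁ := c₁)) (Sinv f))) =
      ((a : ℝ) : ℂ) • (S ∘ₗ LinearMap.adjoint (QkW L m n φ U hL α hα1 hU1 hreg (c₀ := c₀) (c₁ := c₁)) ∘ₗ SFinv) ((SF ∘ₗ (QkW L m n φ U hL α hα1 hU1 hreg (c₀ := c₀) (c₁ := c₁)) ∘ₗ Sinv) f) := by
  simp only [LinearMap.comp_apply, map_smul, hSFi]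

include hS hSinv hSFi hSFs in
/-- **THE CONJUGATE OF `(QG₁Q*)⁻¹` IS A RIGHT INVERSE OF THE CONJUGATED GRAM OPERATOR**:
`(S_FQS⁻¹)((SG₁S⁻¹)((SQ†S_F⁻¹)((S_F(QG₁Q*)⁻¹S_F⁻¹)v))) = v` — `S⁻¹S = 1` twice, `S_F⁻¹S_F = 1`, [B11] (45)'s `QG₁Q*(QG₁Q*)⁻¹ = 1` (`hK_lattice`, PROVED in the
tree), `S_FS_F⁻¹ = 1`. [cite: Balaban1985Variational, (45) p.285, (110) p.294; Balaban1985BackgroundPropagators, (3.49) p.399] -/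
theorem conjKinv_rightInverse
    (hpos : ∀ x : BondL2K ℂ d (towerP L m (n + 1)) c₀ W, x ≠ 0 → 0 < RCLike.re ⟪x, laplaceAk L m n φ η U hL α hα1 hU1 hreg τ (c₀ := c₀) (c₁ := c₁) a x⟫_ℂ) (hQs : Function.Surjective (QkW L m n φ U hL α hα1 hU1 hreg (c₀ := c₀) (c₁ := c₁))) (v : BondL2K ℂ d m c₁ W) :
    (SF ∘ₗ (QkW L m n φ U hL α hα1 hU1 hreg (c₀ := c₀) (c₁ := c₁)) ∘ₗ Sinv) ((S ∘ₗ G1k L m n φ η U hL α hα1 hU1 hreg τ (c₀ := c₀) (c₁ := c₁) hpos ∘ₗ Sinv) ((S ∘ₗ LinearMap.adjoint (QkW L m n φ U hL α hα1 hU1 hreg (c₀ := c₀) (c₁ := c₁)) ∘ₗ SFinv) ((SF ∘ₗ KinvLatticeK hpos hQs ∘ₗ SFinv) v))) = v := by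
  simp only [LinearMap.comp_apply]
  rw [apply_inv_apply' κ (fun b : Bond d (towerP L m (n + 1)) => χ (bpos b)) hS hSinv, apply_inv_apply' κ (fun b : Bond d (towerP L m (n + 1)) => χ (bpos b)) hS hSinv, hSFi]
  unfold G1k
  rw [hK_lattice hpos hQs, hSFs]

/-- **`G₁(U)(Δ_a(U)f) = f`** — in finite dimension the right inverse `G₁ = Δ_a⁻¹` is a left inverse (`greenK_apply`).
[cite: Balaban1985Variational, (110) p.294; Balaban1985BackgroundPropagators, Thm 3.11 p.416] -/
theorem G1k_laplaceAk
    (hpos : ∀ x : BondL2K ℂ d (towerP L m (n + 1)) c₀ W, x ≠ 0 → 0 < RCLike.re ⟪x, laplaceAk L m n φ η U hL α hα1 hU1 hreg τ (c₀ := c₀) (c₁ := c₁) a x⟫_ℂ) (f : BondL2K ℂ d (towerP L m (n + 1)) c₀ W) :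
    G1k L m n φ η U hL α hα1 hU1 hreg τ (c₀ := c₀) (c₁ := c₁) hpos (laplaceAk L m n φ η U hL α hα1 hU1 hreg τ (c₀ := c₀) (c₁ := c₁) a f) = f := by
  unfold G1k B11Eq103H1Complex.G1LatticeK B11Eq103H1Complex.G1K laplaceAk B11Eq103H1Complex.laplaceALatticeK
  rw [greenK_apply]

/-- **`Δ_a(U)(G₁(U)v) = v`** (`apply_greenK`). [cite: Balaban1985Variational, (110) p.294] -/
theorem laplaceAk_G1k
    (hpos : ∀ x : BondL2K ℂ d (towerP L m (n + 1)) c₀ W, x ≠ 0 → 0 < RCLike.re ⟪x, laplaceAk L m n φ η U hL α hα1 hU1 hreg τ (c₀ := c₀) (c₁ := c₁) a x⟫_ℂ) (v : BondL2K ℂ d (towerP L m (n + 1)) c₀ W) :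
    laplaceAk L m n φ η U hL α hα1 hU1 hreg τ (c₀ := c₀) (c₁ := c₁) a (G1k L m n φ η U hL α hα1 hU1 hreg τ (c₀ := c₀) (c₁ := c₁) hpos v) = v := by
  unfold G1k B11Eq103H1Complex.G1LatticeK B11Eq103H1Complex.G1K laplaceAk B11Eq103H1Complex.laplaceALatticeK
  rw [apply_greenK]

include hS hSinv in
/-- **`(SG₁S⁻¹)((SΔ_aS⁻¹)s) = s`** (`S⁻¹S = 1`, `G₁Δ_a = 1`, `SS⁻¹ = 1`). [cite: Balaban1985Variational, (110) p.294; Balaban1985BackgroundPropagators, (3.49) p.399] -/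
theorem conjInv_conjDeltaAk
    (hpos : ∀ x : BondL2K ℂ d (towerP L m (n + 1)) c₀ W, x ≠ 0 → 0 < RCLike.re ⟪x, laplaceAk L m n φ η U hL α hα1 hU1 hreg τ (c₀ := c₀) (c₁ := c₁) a x⟫_ℂ) (s : BondL2K ℂ d (towerP L m (n + 1)) c₀ W) :
    (S ∘ₗ G1k L m n φ η U hL α hα1 hU1 hreg τ (c₀ := c₀) (c₁ := c₁) hpos ∘ₗ Sinv) ((S ∘ₗ laplaceAk L m n φ η U hL α hα1 hU1 hreg τ (c₀ := c₀) (c₁ := c₁) a ∘ₗ Sinv) s) = s := by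
  simp only [LinearMap.comp_apply]
  rw [apply_inv_apply' κ (fun b : Bond d (towerP L m (n + 1)) => χ (bpos b)) hS hSinv, G1k_laplaceAk,
    apply_apply_inv' κ (fun b : Bond d (towerP L m (n + 1)) => χ (bpos b)) hS hSinv]

/-! ## §1 The four discharged first-order letters (as in `B9Eq326ConjugatedDeltaA.norm_conjG1ofU_le`) -/

omit [NeZero L] [∀ i, NeZero (m i)] [StarRing 𝔸] [StarModule ℂ 𝔸] [CompleteSpace 𝔸] in
include hφ hφ' hMφ hMφ' hη hU hRS hS hSinv hSP hSPinv hSS hSSinv in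
/-- The curl ∕ cocurl ∕ divergence ∕ gradient conjugation letters in the windows `‖κ‖ℓη ≤ 1`, `4‖κ‖ℓM_φM_φ′d√d ≤ β`, `4‖κ‖ℓM_φM_φ′d ≤ β`, `2‖κ‖ℓM_φM_φ′√d ≤ β`:
`‖S_PB₁S⁻¹ − B₁‖`, `‖SB₁†S_P⁻¹ − B₁†‖`, `‖S_SB₂S⁻¹ − B₂‖`, `‖SB₂†S_S⁻¹ − B₂†‖ ≤ β` (`B9Eq3101ConjugationLettersCurl` ∕ `…CoCurl` ∕ `…Chain`).
[cite: Balaban1985BackgroundPropagators, (3.3)–(3.8) p.391, (3.49) p.399] -/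
theorem conj_letters {β ℓ : ℝ} (hℓ : 0 ≤ ℓ)
    (hχ : ∀ b : Bond d (towerP L m (n + 1)), |χ (bpos b) - χ (btgt b)| ≤ ℓ * η) (hwin : ‖κ‖ * ℓ * η ≤ 1)
    (hβCC : 4 * ‖κ‖ * ℓ * (Mφ * Mφ') * (d * Real.sqrt d) ≤ β) (hβC : 4 * ‖κ‖ * ℓ * (Mφ * Mφ') * d ≤ β)
    (hβD : 2 * ‖κ‖ * ℓ * (Mφ * Mφ') * Real.sqrt d ≤ β) :
    (∀ f, ‖(SP ∘ₗ covCurlL2K ℂ c₀ ((η : ℂ))⁻¹ (adTransportW φ U) ∘ₗ Sinv) f - covCurlL2K ℂ c₀ ((η : ℂ))⁻¹ (adTransportW φ U) f‖ ≤ β * ‖f‖) ∧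
    (∀ p, ‖(S ∘ₗ covCoCurlL2K ℂ c₀ ((η : ℂ))⁻¹ (adTransportW φ fun b => (U b)⁻¹) ∘ₗ SPinv) p -
      LinearMap.adjoint (covCurlL2K ℂ c₀ ((η : ℂ))⁻¹ (adTransportW φ U)) p‖ ≤ β * ‖p‖) ∧
    (∀ f, ‖(SS ∘ₗ covDivL2K ℂ c₀ ((η : ℂ))⁻¹ (adTransportW φ fun b => (U b)⁻¹) ∘ₗ Sinv) f -
      covDivL2K ℂ c₀ ((η : ℂ))⁻¹ (adTransportW φ fun b => (U b)⁻¹) f‖ ≤ β * ‖f‖) ∧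
    (∀ s, ‖(S ∘ₗ covDerivL2K ℂ c₀ ((η : ℂ))⁻¹ (adTransportW φ U) ∘ₗ SSinv) s -
      LinearMap.adjoint (covDivL2K ℂ c₀ ((η : ℂ))⁻¹ (adTransportW φ fun b => (U b)⁻¹)) s‖ ≤ β * ‖s‖) := by
  have hR : ∀ (b : Bond d (towerP L m (n + 1))) (w : W), ‖adTransportW φ U b w‖ ≤ Mφ * Mφ' * ‖w‖ :=
    fun b w => norm_adTransportW_le φ hφ hφ' hMφ' U b (hU b) w
  have hSad : ∀ (b : Bond d (towerP L m (n + 1))) (w : W), ‖adTransportW φ (fun b => (U b)⁻¹) b w‖ ≤ Mφ * Mφ' * ‖w‖ :=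
    fun b w => norm_adTransportW_le φ hφ hφ' hMφ' (fun b => (U b)⁻¹) b ((U1 𝔸).inv_mem (hU b)) w
  have hMT : 0 ≤ Mφ * Mφ' := mul_nonneg hMφ hMφ'
  have hθ : 0 ≤ ℓ * η := mul_nonneg hℓ hη.le
  have hwin' : ‖κ‖ * (ℓ * η) ≤ 1 := by simpa [mul_assoc] using hwin
  have hcθ : ‖((η : ℂ))⁻¹‖ * (ℓ * η) = ℓ := by
    rw [norm_inv, Complex.norm_real, Real.norm_eq_abs, abs_of_pos hη]; field_simp
  have h1 : LinearMap.adjoint (covCurlL2K ℂ c₀ ((η : ℂ))⁻¹ (adTransportW φ U)) =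
      covCoCurlL2K ℂ c₀ ((η : ℂ))⁻¹ (adTransportW φ fun b => (U b)⁻¹) := adjoint_covCurlL2K _ (conj_inv_eta' η) _ _ hRS
  have h2 : LinearMap.adjoint (covDivL2K ℂ c₀ ((η : ℂ))⁻¹ (adTransportW φ fun b => (U b)⁻¹)) =
      covDerivL2K ℂ c₀ ((η : ℂ))⁻¹ (adTransportW φ U) := by
    rw [← adjoint_covDerivL2K ((η : ℂ))⁻¹ (conj_inv_eta' η) _ _ hRS, LinearMap.adjoint_adjoint]
  refine ⟨fun f => ?_, fun p => ?_, fun f => ?_, fun s => ?_⟩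
  · have h := norm_mulOp_covCurlL2K_sub_le hθ hMT hR hχ hwin' ((η : ℂ))⁻¹ SP hSP Sinv hSinv f
    simp only [LinearMap.comp_apply]
    refine h.trans ?_
    calc 4 * ‖((η : ℂ))⁻¹‖ * ‖κ‖ * (ℓ * η) * (Mφ * Mφ') * d * ‖f‖ = 4 * ‖κ‖ * ℓ * (Mφ * Mφ') * d * ‖f‖ := by
          rw [show 4 * ‖((η : ℂ))⁻¹‖ * ‖κ‖ * (ℓ * η) = 4 * ‖κ‖ * (‖((η : ℂ))⁻¹‖ * (ℓ * η)) by ring, hcθ]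
      _ ≤ β * ‖f‖ := mul_le_mul_of_nonneg_right hβC (norm_nonneg _)
  · rw [h1]
    have h := norm_mulOp_covCoCurlL2K_sub_le hθ hMT hSad hχ hwin' ((η : ℂ))⁻¹ S hS SPinv hSPinv p
    simp only [LinearMap.comp_apply]
    refine h.trans ?_
    calc 4 * ‖((η : ℂ))⁻¹‖ * ‖κ‖ * (ℓ * η) * (Mφ * Mφ') * (d * Real.sqrt d) * ‖p‖ = 4 * ‖κ‖ * ℓ * (Mφ * Mφ') * (d * Real.sqrt d) * ‖p‖ := by
          rw [show 4 * ‖((η : ℂ))⁻¹‖ * ‖κ‖ * (ℓ * η) = 4 * ‖κ‖ * (‖((η : ℂ))⁻¹‖ * (ℓ * η)) by ring, hcθ]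
      _ ≤ β * ‖p‖ := mul_le_mul_of_nonneg_right hβCC (norm_nonneg _)
  · have h := norm_mulOp_covDivL2K_sub_le hθ hMT hSad hχ hwin' ((η : ℂ))⁻¹ SS hSS Sinv hSinv f
    simp only [LinearMap.comp_apply]
    refine h.trans ?_
    calc 2 * ‖((η : ℂ))⁻¹‖ * ‖κ‖ * (ℓ * η) * (Mφ * Mφ') * Real.sqrt d * ‖f‖ = 2 * ‖κ‖ * ℓ * (Mφ * Mφ') * Real.sqrt d * ‖f‖ := by
          rw [show 2 * ‖((η : ℂ))⁻¹‖ * ‖κ‖ * (ℓ * η) = 2 * ‖κ‖ * (‖((η : ℂ))⁻¹‖ * (ℓ * η)) by ring, hcθ]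
      _ ≤ β * ‖f‖ := mul_le_mul_of_nonneg_right hβD (norm_nonneg _)
  · rw [h2]
    have h := norm_mulOp_covDerivL2K_adTransportW_sub_le φ hφ hφ' hMφ hMφ' hη hℓ U hU hχ hwin S hS SSinv hSSinv s
    simp only [LinearMap.comp_apply]
    exact h.trans (mul_le_mul_of_nonneg_right hβD (norm_nonneg _))

/-! ## §2 The seam of the second Gram operator and the bound of the conjugated `(QG₁Q*)⁻¹` -/

include hφ hφ' hMφ hMφ' hη hU hRS hS hSinv hSP hSPinv hSS hSSinv hSFi in
/-- **THE CONJUGATED SECOND GRAM OPERATOR AGAINST `QG₁Q†`**: `‖(S_FQS⁻¹)((SG₁S⁻¹)((SQ†S_F⁻¹)g)) − Q(G₁(Q†g))‖ ≤ s₁‖g‖` —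
`B9Eq3126ConjugatedQG1QLetters.norm_X1k_sub_X1_le` at the chain, curl ∕ div ∕ grad letters discharged, both inverse identities proved, the rest displayed.
[folklore] [cite: Balaban1985BackgroundPropagators, (3.126) p.420, (3.49) p.399, (3.26) p.395, Thm 3.11 p.416; Balaban1985Variational, (45) p.285, (110) p.294] -/
theorem norm_conjX1_sub_X1_le (ha : 0 ≤ a)
    (hpos : ∀ x : BondL2K ℂ d (towerP L m (n + 1)) c₀ W, x ≠ 0 → 0 < RCLike.re ⟪x, laplaceAk L m n φ η U hL α hα1 hU1 hreg τ (c₀ := c₀) (c₁ := c₁) a x⟫_ℂ)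
    {γ β βK pK ℓ ρ CP CQ : ℝ} (hγ : 0 < γ) (hγ1 : γ ≤ 1) (hβ : 0 ≤ β) (hβ1 : β ≤ 1) (hβK : 0 ≤ βK) (hℓ : 0 ≤ ℓ) (hρ : 0 ≤ ρ) (hρ8 : ρ ≤ 1 / 8)
    (hCP : 0 ≤ CP) (hCQ : 0 ≤ CQ)
    (hcoer : ∀ f : BondL2K ℂ d (towerP L m (n + 1)) c₀ W, γ * ‖f‖ ^ 2 ≤ RCLike.re ⟪f, laplaceAk L m n φ η U hL α hα1 hU1 hreg τ (c₀ := c₀) (c₁ := c₁) a f⟫_ℂ)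
    (hKre : ∀ f : BondL2K ℂ d (towerP L m (n + 1)) c₀ W, -(pK * ‖f‖ ^ 2) ≤ RCLike.re ⟪f, curvOp φ τ η U f⟫_ℂ)
    (hQ : ∀ f, ‖(QkW L m n φ U hL α hα1 hU1 hreg (c₀ := c₀) (c₁ := c₁)) f‖ ≤ CQ * ‖f‖)
    (hχ : ∀ b : Bond d (towerP L m (n + 1)), |χ (bpos b) - χ (btgt b)| ≤ ℓ * η) (hwin : ‖κ‖ * ℓ * η ≤ 1)
    (hβCC : 4 * ‖κ‖ * ℓ * (Mφ * Mφ') * (d * Real.sqrt d) ≤ β) (hβC : 4 * ‖κ‖ * ℓ * (Mφ * Mφ') * d ≤ β)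
    (hβD : 2 * ‖κ‖ * ℓ * (Mφ * Mφ') * Real.sqrt d ≤ β)
    (dQ : ∀ f, ‖(SF ∘ₗ (QkW L m n φ U hL α hα1 hU1 hreg (c₀ := c₀) (c₁ := c₁)) ∘ₗ Sinv) f - (QkW L m n φ U hL α hα1 hU1 hreg (c₀ := c₀) (c₁ := c₁)) f‖ ≤ β * ‖f‖) (dQ' : ∀ g, ‖(S ∘ₗ LinearMap.adjoint (QkW L m n φ U hL α hα1 hU1 hreg (c₀ := c₀) (c₁ := c₁)) ∘ₗ SFinv) g - LinearMap.adjoint (QkW L m n φ U hL α hα1 hU1 hreg (c₀ := c₀) (c₁ := c₁)) g‖ ≤ β * ‖g‖)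
    (dK : ∀ f, ‖(S ∘ₗ curvOp φ τ η U ∘ₗ Sinv) f - curvOp φ τ η U f‖ ≤ βK * ‖f‖)
    (dR : ∀ s, ‖(SS ∘ₗ RofUk L m n φ η U (c₀ := c₀) ∘ₗ SSinv) s - RofUk L m n φ η U (c₀ := c₀) s‖ ≤ ρ * ‖s‖)
    (hP : ∀ f, ‖covDivL2K ℂ c₀ ((η : ℂ))⁻¹ (adTransportW φ fun b => (U b)⁻¹) f -
      RofUk L m n φ η U (c₀ := c₀) (covDivL2K ℂ c₀ ((η : ℂ))⁻¹ (adTransportW φ fun b => (U b)⁻¹) f)‖ ≤ CP * ‖f‖)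
    (small : pK / 2 + (21 + 3 * a) * β ^ 2 + 4 * β * CP + 2 * ρ * CP ^ 2 + βK ≤ γ / 4) (g : BondL2K ℂ d m c₁ W) :
    ‖(SF ∘ₗ (QkW L m n φ U hL α hα1 hU1 hreg (c₀ := c₀) (c₁ := c₁)) ∘ₗ Sinv) ((S ∘ₗ G1k L m n φ η U hL α hα1 hU1 hreg τ (c₀ := c₀) (c₁ := c₁) hpos ∘ₗ Sinv) ((S ∘ₗ LinearMap.adjoint (QkW L m n φ U hL α hα1 hU1 hreg (c₀ := c₀) (c₁ := c₁)) ∘ₗ SFinv) g)) -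
        (QkW L m n φ U hL α hα1 hU1 hreg (c₀ := c₀) (c₁ := c₁)) (G1k L m n φ η U hL α hα1 hU1 hreg τ (c₀ := c₀) (c₁ := c₁) hpos (LinearMap.adjoint (QkW L m n φ U hL α hα1 hU1 hreg (c₀ := c₀) (c₁ := c₁)) g))‖ ≤
      (β * (4 / γ) * (2 * CQ + 1) + CQ * (CQ + 1) *
        (β * (4 / γ * (2 * (8 / γ) + (8 / γ + 4 / γ) + 2 * ((8 / γ + 4 / γ * CP) + 4 / γ) + a * CQ * (4 / γ) + a * (CQ + 1) * (4 / γ))) +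
          ρ * ((8 / γ + 4 / γ * CP) * ((8 / γ + 4 / γ * CP) + 4 / γ)) + βK * (4 / γ) ^ 2)) * ‖g‖ := by
  obtain ⟨dB₁, dB₁', dB₂, dB₂'⟩ := conj_letters L m n φ hφ hφ' hMφ hMφ' hη U hU hRS (κ := κ) (χ := χ) hS hSinv hSP hSPinv hSS hSSinv hℓ hχ hwin hβCC hβC hβD
  have hRsq := re_inner_RofUk_eq L m n φ (η := η) (c₀ := c₀) U
  have hR1 := norm_RofUk_le L m n φ (η := η) (c₀ := c₀) U
  have hRsa : ∀ x y, ⟪RofUk L m n φ η U (c₀ := c₀) x, y⟫_ℂ = ⟪x, RofUk L m n φ η U (c₀ := c₀) y⟫_ℂ := fun x y => RofUk_isSymmetric L m n φ η U (c₀ := c₀) x y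
  have hH := deltaAk_structure L m n φ (c₀ := c₀) (c₁ := c₁) (η := η) U hRS τ hL α hα1 hU1 hreg a
  have hHk := conjDeltaAk_apply L m n φ (η := η) U hRS τ hL α hα1 hU1 hreg a (κ := κ) (χ := χ) (S := S) (Sinv := Sinv) hSP hSPinv hSS hSSinv
    (SF ∘ₗ (QkW L m n φ U hL α hα1 hU1 hreg (c₀ := c₀) (c₁ := c₁)) ∘ₗ Sinv) (S ∘ₗ LinearMap.adjoint (QkW L m n φ U hL α hα1 hU1 hreg (c₀ := c₀) (c₁ := c₁)) ∘ₗ SFinv) (X1_factorisation L m n φ U hL α hα1 hU1 hreg a hSFi S Sinv)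
  have hHG := laplaceAk_G1k L m n φ U τ hL α hα1 hU1 hreg a hpos
  have hHkGk := conjDeltaAk_conjInv L m n φ U τ hL α hα1 hU1 hreg a (κ := κ) (χ := χ) hS hSinv hpos
  have hGkHk := conjInv_conjDeltaAk L m n φ U τ hL α hα1 hU1 hreg a (κ := κ) (χ := χ) hS hSinv hpos
  exact norm_X1k_sub_X1_le (covCurlL2K ℂ c₀ ((η : ℂ))⁻¹ (adTransportW φ U)) (covDivL2K ℂ c₀ ((η : ℂ))⁻¹ (adTransportW φ fun b => (U b)⁻¹))
    (RofUk L m n φ η U (c₀ := c₀)) (QkW L m n φ U hL α hα1 hU1 hreg (c₀ := c₀) (c₁ := c₁)) (curvOp φ τ η U) (laplaceAk L m n φ η U hL α hα1 hU1 hreg τ (c₀ := c₀) (c₁ := c₁) a) (G1k L m n φ η U hL α hα1 hU1 hreg τ (c₀ := c₀) (c₁ := c₁) hpos) a γ β βK pK ρ CP CQ _ _ _ _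
    (SS ∘ₗ RofUk L m n φ η U (c₀ := c₀) ∘ₗ SSinv) (SF ∘ₗ (QkW L m n φ U hL α hα1 hU1 hreg (c₀ := c₀) (c₁ := c₁)) ∘ₗ Sinv) (S ∘ₗ LinearMap.adjoint (QkW L m n φ U hL α hα1 hU1 hreg (c₀ := c₀) (c₁ := c₁)) ∘ₗ SFinv) (S ∘ₗ curvOp φ τ η U ∘ₗ Sinv)
    (S ∘ₗ laplaceAk L m n φ η U hL α hα1 hU1 hreg τ (c₀ := c₀) (c₁ := c₁) a ∘ₗ Sinv) (S ∘ₗ G1k L m n φ η U hL α hα1 hU1 hreg τ (c₀ := c₀) (c₁ := c₁) hpos ∘ₗ Sinv)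
    ha hγ hγ1 hβ hβ1 hβK hρ hρ8 hCP hCQ hRsq hR1 hRsa hH hcoer hKre hP hQ dB₁ dB₁' dB₂ dB₂' dR dQ dQ' dK small hHk hHG hHkGk hGkHk g

include hφ hφ' hMφ hMφ' hη hU hRS hS hSinv hSP hSPinv hSS hSSinv hSFi hSFs in
/-- **THE CONJUGATED INVERSE GRAM OPERATOR IS BOUNDED BY `2∕μ₁`: `‖(S_F∘(QG₁Q*)⁻¹∘S_F⁻¹)v‖ ≤ (2∕μ₁)‖v‖`** —
`B9Eq3126ConjugatedQG1QLetters.norm_c1k_le` at the chain's `Δ_a(U)`, `G₁(U)`, `(QG₁Q*)⁻¹ = KinvLatticeK` with the right-inverse identity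
`conjKinv_rightInverse` PROVED; curl ∕ div ∕ grad letters discharged in the windows; DISPLAYED: `γ` (Thm 3.11), `μ₁` ([B11] (45)'s lower bound of
`QG₁Q†`), `p_K`, `β_K`, `C_Q`, the `Q(U)` seams, `ρ ≤ 1∕8`, `C_P`, and the windows `small`, `small2` — every `U`, `χ`, `κ` of the letters, NO `η`,
NO volume. [folklore] [cite: Balaban1985Variational, (45) p.285, (103) p.293, (110) p.294; Balaban1985BackgroundPropagators, (3.126) p.420, (3.49) p.399,
Thm 3.11 p.416] -/
theorem norm_conjKinv_le (ha : 0 ≤ a)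
    (hpos : ∀ x : BondL2K ℂ d (towerP L m (n + 1)) c₀ W, x ≠ 0 → 0 < RCLike.re ⟪x, laplaceAk L m n φ η U hL α hα1 hU1 hreg τ (c₀ := c₀) (c₁ := c₁) a x⟫_ℂ) (hQs : Function.Surjective (QkW L m n φ U hL α hα1 hU1 hreg (c₀ := c₀) (c₁ := c₁)))
    {γ β βK pK ℓ ρ CP CQ μ₁ : ℝ} (hγ : 0 < γ) (hγ1 : γ ≤ 1) (hβ : 0 ≤ β) (hβ1 : β ≤ 1) (hβK : 0 ≤ βK) (hℓ : 0 ≤ ℓ) (hρ : 0 ≤ ρ) (hρ8 : ρ ≤ 1 / 8)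
    (hCP : 0 ≤ CP) (hCQ : 0 ≤ CQ) (hμ₁ : 0 < μ₁)
    (hcoer : ∀ f : BondL2K ℂ d (towerP L m (n + 1)) c₀ W, γ * ‖f‖ ^ 2 ≤ RCLike.re ⟪f, laplaceAk L m n φ η U hL α hα1 hU1 hreg τ (c₀ := c₀) (c₁ := c₁) a f⟫_ℂ)
    (hX1 : ∀ g : BondL2K ℂ d m c₁ W, μ₁ * ‖g‖ ^ 2 ≤ RCLike.re ⟪g, (QkW L m n φ U hL α hα1 hU1 hreg (c₀ := c₀) (c₁ := c₁)) (G1k L m n φ η U hL α hα1 hU1 hreg τ (c₀ := c₀) (c₁ := c₁) hpos (LinearMap.adjoint (QkW L m n φ U hL α hα1 hU1 hreg (c₀ := c₀) (c₁ := c₁)) g))⟫_ℂ)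
    (hKre : ∀ f : BondL2K ℂ d (towerP L m (n + 1)) c₀ W, -(pK * ‖f‖ ^ 2) ≤ RCLike.re ⟪f, curvOp φ τ η U f⟫_ℂ)
    (hQ : ∀ f, ‖(QkW L m n φ U hL α hα1 hU1 hreg (c₀ := c₀) (c₁ := c₁)) f‖ ≤ CQ * ‖f‖)
    (hχ : ∀ b : Bond d (towerP L m (n + 1)), |χ (bpos b) - χ (btgt b)| ≤ ℓ * η) (hwin : ‖κ‖ * ℓ * η ≤ 1)
    (hβCC : 4 * ‖κ‖ * ℓ * (Mφ * Mφ') * (d * Real.sqrt d) ≤ β) (hβC : 4 * ‖κ‖ * ℓ * (Mφ * Mφ') * d ≤ β)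
    (hβD : 2 * ‖κ‖ * ℓ * (Mφ * Mφ') * Real.sqrt d ≤ β)
    (dQ : ∀ f, ‖(SF ∘ₗ (QkW L m n φ U hL α hα1 hU1 hreg (c₀ := c₀) (c₁ := c₁)) ∘ₗ Sinv) f - (QkW L m n φ U hL α hα1 hU1 hreg (c₀ := c₀) (c₁ := c₁)) f‖ ≤ β * ‖f‖) (dQ' : ∀ g, ‖(S ∘ₗ LinearMap.adjoint (QkW L m n φ U hL α hα1 hU1 hreg (c₀ := c₀) (c₁ := c₁)) ∘ₗ SFinv) g - LinearMap.adjoint (QkW L m n φ U hL α hα1 hU1 hreg (c₀ := c₀) (c₁ := c₁)) g‖ ≤ β * ‖g‖)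
    (dK : ∀ f, ‖(S ∘ₗ curvOp φ τ η U ∘ₗ Sinv) f - curvOp φ τ η U f‖ ≤ βK * ‖f‖)
    (dR : ∀ s, ‖(SS ∘ₗ RofUk L m n φ η U (c₀ := c₀) ∘ₗ SSinv) s - RofUk L m n φ η U (c₀ := c₀) s‖ ≤ ρ * ‖s‖)
    (hP : ∀ f, ‖covDivL2K ℂ c₀ ((η : ℂ))⁻¹ (adTransportW φ fun b => (U b)⁻¹) f -
      RofUk L m n φ η U (c₀ := c₀) (covDivL2K ℂ c₀ ((η : ℂ))⁻¹ (adTransportW φ fun b => (U b)⁻¹) f)‖ ≤ CP * ‖f‖)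
    (small : pK / 2 + (21 + 3 * a) * β ^ 2 + 4 * β * CP + 2 * ρ * CP ^ 2 + βK ≤ γ / 4)
    (small2 : β * (4 / γ) * (2 * CQ + 1) + CQ * (CQ + 1) *
        (β * (4 / γ * (2 * (8 / γ) + (8 / γ + 4 / γ) + 2 * ((8 / γ + 4 / γ * CP) + 4 / γ) + a * CQ * (4 / γ) + a * (CQ + 1) * (4 / γ))) +
          ρ * ((8 / γ + 4 / γ * CP) * ((8 / γ + 4 / γ * CP) + 4 / γ)) + βK * (4 / γ) ^ 2) ≤ μ₁ / 2) (v : BondL2K ℂ d m c₁ W) :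
    ‖(SF ∘ₗ KinvLatticeK hpos hQs ∘ₗ SFinv) v‖ ≤ 2 / μ₁ * ‖v‖ := by
  obtain ⟨dB₁, dB₁', dB₂, dB₂'⟩ := conj_letters L m n φ hφ hφ' hMφ hMφ' hη U hU hRS (κ := κ) (χ := χ) hS hSinv hSP hSPinv hSS hSSinv hℓ hχ hwin hβCC hβC hβD
  have hRsq := re_inner_RofUk_eq L m n φ (η := η) (c₀ := c₀) U
  have hR1 := norm_RofUk_le L m n φ (η := η) (c₀ := c₀) U
  have hRsa : ∀ x y, ⟪RofUk L m n φ η U (c₀ := c₀) x, y⟫_ℂ = ⟪x, RofUk L m n φ η U (c₀ := c₀) y⟫_ℂ := fun x y => RofUk_isSymmetric L m n φ η U (c₀ := c₀) x y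
  have hH := deltaAk_structure L m n φ (c₀ := c₀) (c₁ := c₁) (η := η) U hRS τ hL α hα1 hU1 hreg a
  have hHk := conjDeltaAk_apply L m n φ (η := η) U hRS τ hL α hα1 hU1 hreg a (κ := κ) (χ := χ) (S := S) (Sinv := Sinv) hSP hSPinv hSS hSSinv
    (SF ∘ₗ (QkW L m n φ U hL α hα1 hU1 hreg (c₀ := c₀) (c₁ := c₁)) ∘ₗ Sinv) (S ∘ₗ LinearMap.adjoint (QkW L m n φ U hL α hα1 hU1 hreg (c₀ := c₀) (c₁ := c₁)) ∘ₗ SFinv) (X1_factorisation L m n φ U hL α hα1 hU1 hreg a hSFi S Sinv)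
  have hHG := laplaceAk_G1k L m n φ U τ hL α hα1 hU1 hreg a hpos
  have hHkGk := conjDeltaAk_conjInv L m n φ U τ hL α hα1 hU1 hreg a (κ := κ) (χ := χ) hS hSinv hpos
  have hGkHk := conjInv_conjDeltaAk L m n φ U τ hL α hα1 hU1 hreg a (κ := κ) (χ := χ) hS hSinv hpos
  have hck := conjKinv_rightInverse L m n φ U τ hL α hα1 hU1 hreg a (κ := κ) (χ := χ) hS hSinv hSFi hSFs hpos hQs
  exact norm_c1k_le (covCurlL2K ℂ c₀ ((η : ℂ))⁻¹ (adTransportW φ U)) (covDivL2K ℂ c₀ ((η : ℂ))⁻¹ (adTransportW φ fun b => (U b)⁻¹))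
    (RofUk L m n φ η U (c₀ := c₀)) (QkW L m n φ U hL α hα1 hU1 hreg (c₀ := c₀) (c₁ := c₁)) (curvOp φ τ η U) (laplaceAk L m n φ η U hL α hα1 hU1 hreg τ (c₀ := c₀) (c₁ := c₁) a) (G1k L m n φ η U hL α hα1 hU1 hreg τ (c₀ := c₀) (c₁ := c₁) hpos) a γ β βK pK ρ CP CQ _ _ _ _
    (SS ∘ₗ RofUk L m n φ η U (c₀ := c₀) ∘ₗ SSinv) (SF ∘ₗ (QkW L m n φ U hL α hα1 hU1 hreg (c₀ := c₀) (c₁ := c₁)) ∘ₗ Sinv) (S ∘ₗ LinearMap.adjoint (QkW L m n φ U hL α hα1 hU1 hreg (c₀ := c₀) (c₁ := c₁)) ∘ₗ SFinv) (S ∘ₗ curvOp φ τ η U ∘ₗ Sinv)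
    (S ∘ₗ laplaceAk L m n φ η U hL α hα1 hU1 hreg τ (c₀ := c₀) (c₁ := c₁) a ∘ₗ Sinv) (S ∘ₗ G1k L m n φ η U hL α hα1 hU1 hreg τ (c₀ := c₀) (c₁ := c₁) hpos ∘ₗ Sinv)
    ha hγ hγ1 hβ hβ1 hβK hρ hρ8 hCP hCQ hRsq hR1 hRsa hH hcoer hKre hP hQ dB₁ dB₁' dB₂ dB₂' dR dQ dQ' dK small hHk hHG hHkGk hGkHk
    hμ₁ hX1 (SF ∘ₗ KinvLatticeK hpos hQs ∘ₗ SFinv) hck small2 v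

end Instance

end Literature.MathematicalPhysics.QuantumFieldTheory.Balaban1983to89.B9Eq3126ConjugatedQG1QInvTower

end
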